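import Mathlib.Algebra.Group.Submonoid.Membership
import Mathlib.Algebra.Group.Pi.Lemmas
import Mathlib.Algebra.Group.Equiv.Basic
import Mathlib.Data.Fintype.BigOperators
import Mathlib.Algebra.BigOperators.Group.Finset.Basic
import HarnessLib

/-!
# [IUTchII] Corollaries 3.5, 3.6: value-profiles and Gaussian monoids at bad primes

S. Mochizuki, *Inter-universal Teichmüller theory II*, §3 "Tempered Gaussian Frobenioids",
Corollary 3.5 (mono-theta-theoretic Gaussian monoids, kurims Dec-2020 manuscript pp. 93–96)
and Corollary 3.6 (Frobenioid-theoretic Gaussian monoids, pp. 99–101), with Remarks 3.5.1,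
3.5.3, 3.6.1 [cite: Mochizuki2012, Cor 3.5 p.93]. Claim key DISPUTED (D-0012): definitions and
Prop-valued statements only; nothing here asserts a disputed claim.

**What is printed.** (3.5 (ii), p. 94–95) "We shall refer to an element of the set
`θ^{F_l^⋇}_env(M^Θ_*▶) := ∏_{|t| ∈ F_l^⋇} θ^{|t|}_env(M^Θ_*▶) ⊆ ∏_{|t| ∈ F_l^⋇} Ψ_cns(M^Θ_*)_{|t|}` —
which is of cardinality `(2l)^{l⋇}` — as a value-profile"; the Gaussian monoids
`Ψ_ξ(M^Θ_*) := Ψ^×_cns(M^Θ_*)_{⟨F_l^⋇⟩} · ξ^ℕ`, `∞Ψ_ξ(M^Θ_*) := Ψ^×_cns(M^Θ_*)_{⟨F_l^⋇⟩} · ξ^{ℚ≥0}`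
inside `∏_{|t|} Ψ_cns(M^Θ_*)_{|t|}`, `ξ` ranging over the value-profiles; "the submonoid
`Ψ_{2l·ξ}(M^Θ_*) ⊆ Ψ_ξ(M^Θ_*)` generated by `Ψ^×_cns(M^Θ_*)_{⟨F_l^⋇⟩}` and `ξ^{2l·ℕ}` is independent of
the value-profile `ξ`"; restriction morphisms `Ψ^ι_env ⥲ Ψ_ξ`, `∞Ψ^ι_env ⥲ ∞Ψ_ξ`. (3.5 (iii),
p. 95) "the diagonal submonoid `Ψ_cns(M^Θ_*)_{⟨|F_l|⟩}` determines — i.e., may be thought of as the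
graph of — an isomorphism of monoids `Ψ_cns(M^Θ_*)_0 ⥲ Ψ_cns(M^Θ_*)_{⟨F_l^⋇⟩}`"; "a splitting up
to torsion of each of the Gaussian monoids `Ψ_ξ = Ψ^×_{⟨F_l^⋇⟩} · ξ^ℕ`, `∞Ψ_ξ = Ψ^×_{⟨F_l^⋇⟩} · ξ^{ℚ≥0}`".
(3.6 (ii)–(iii), p. 99–100) `Ψ_{F_ξ}(†F_v) ⊆ ∞Ψ_{F_ξ}(†F_v) ⊆ ∏_{|t|} (Ψ_{†C_v})_{|t|}`, "the submonoids
determined, respectively, via the isomorphisms `(Ψ_{†C_v})_{|t|} ⥲ Ψ_cns(M^Θ_*)_{|t|}` of (i), by the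
monoids `Ψ_ξ`, `∞Ψ_ξ`"; `Ψ_{F_ξ}(†F_v) = (Ψ^×_{†C_v})_{⟨F_l^⋇⟩} · Im(ξ)^ℕ`.

**Dictionary.** The label set `F_l^⋇` is an abstract finite type `T` (`Fintype.card T = l⋇`;
owner abc-iut-L5-t1). The constant monoid `Ψ_cns(M^Θ_*) ≅ O^▷_{F̄_v}` is an abstract `CommMonoid M`;
its labeled copies are literal copies, so `∏_{|t|} Ψ_cns,|t| = (T → M)` and the diagonal of the
units `Ψ^×_cns,⟨F_l^⋇⟩` is the submonoid of constant unit families (`unitDiagonal`). The theta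
values `θ^{|t|}_env ⊆ Ψ_cns,|t|` at the label `|t|` (output of Cor 2.8 (i)–(ii): the
`μ_{2l}`-orbit of "`q_v^{j²}`", Remark 2.5.1) are INPUT DATA (`ValueProfileData`: a finite set of
`2l` elements at each label forming one orbit under `2l`-th roots of unity; owner abc-iut-L6-t1).
`ξ^{ℚ≥0}` is the submonoid generated by "the set of elements for which some [positive integer]
power is equal to a [positive integer] power of `ξ`" (Example 3.2 (i) p. 88), `rootPowers ξ` (both
exponents positive; v2, ref-b PASS-8 B6). Galois actions, topologies and the
restriction/Kummer isomorphisms of 3.5 (i)/(ii), 3.6 (i)/(ii) are recorded as Prop-valued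
interface fields quoting print (`Cor35Statements`); the diagonal isomorphism of 3.5 (iii) is
`diagonalIso` of the file on Proposition 4.1.

**Proved here.** `card (θ^{F_l^⋇}) = (2l)^{l⋇}` (`card_valueProfiles`); membership descriptions of
`Ψ_ξ`; `ξ₁^{2l} = ξ₂^{2l}` for value-profiles and the independence `Ψ_{2l·ξ₁} = Ψ_{2l·ξ₂}`
(`gaussianMonoid2l_eq`); `Ψ_{2l·ξ} ≤ Ψ_ξ`; the Frobenioid-theoretic transport
`Ψ_{F_ξ} = (Ψ^×_{†C_v})_{⟨F_l^⋇⟩} · Im(ξ)^ℕ` (`frobenioidGaussianMonoid_eq`).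
-/

namespace Literature.IUT.HodgeArakelov

open scoped BigOperators

universe u v w

section BadPrime

variable {T : Type u} {M : Type v} [CommMonoid M]

/-! ### 1. Diagonal units and the monoids `ξ^ℕ`, `ξ^{ℚ≥0}` -/

/-- `Ψ^×_{⟨F_l^⋇⟩} ⊆ ∏_{|t| ∈ F_l^⋇} Ψ_{|t|}`: the diagonal image of the units of `Ψ` in the product
of its labeled copies ([IUTchII] Cor 3.5 (ii) p. 94, "where the superscript `×` denotes the
submonoid of units"; the diagonal embedding "`⟨F_l^⋇⟩`" of Cor 3.5 (i) p. 94).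
[cite: Mochizuki2012, Cor 3.5 (ii) p.94] -/
def unitDiagonal (T : Type u) (M : Type v) [CommMonoid M] : Submonoid (T → M) where
  carrier := {x | ∃ u : Mˣ, x = fun _ => (u : M)}
  one_mem' := ⟨1, by funext t; simp⟩
  mul_mem' := by
    rintro _ _ ⟨u, rfl⟩ ⟨u', rfl⟩
    exact ⟨u * u', by funext t; simp⟩

/-- Membership in the unit diagonal. [cite: Mochizuki2012, Cor 3.5 (ii) p.94] -/
theorem mem_unitDiagonal (x : T → M) : x ∈ unitDiagonal T M ↔ ∃ u : Mˣ, x = fun _ => (u : M) :=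
  Iff.rfl

/-- The set underlying `ξ^{ℚ≥0}`: "the set of elements for which some [positive integer] power is
equal to a [positive integer] power of" `ξ` ([IUTchII] Example 3.2 (i) p. 88 — BOTH exponents
positive, as printed). [cite: Mochizuki2012, Ex 3.2 (i) p.88] -/
def rootPowerSet {N : Type w} [CommMonoid N] (ξ : N) : Set N :=
  {x | ∃ a b : ℕ, 0 < a ∧ 0 < b ∧ x ^ a = ξ ^ b}

/-- `ξ^{ℚ≥0}` as a monoid: "the submonoid generated by the `N`-th roots [for `N ∈ ℕ_{≥1}`] of `ξ`"
([IUTchII] Cor 3.5 (ii) p. 94–95), recorded as the submonoid GENERATED by the set `rootPowerSet ξ` of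
Example 3.2 (i) p. 88 (so it contains `1` as the empty product and no other torsion is forced in).
REMAINING SLACK (documented, ref-b PASS-8 B6): print pins the `N`-th roots to those "that arise by
restricting elements of `∞θ^ι_env(M^Θ_*)`", unique "up to multiplication by an element of the
`N`-torsion subgroup of `Ψ^×_cns(M^Θ_*)_{⟨F_l^⋇⟩}`" (diagonal torsion); over an abstract monoid this
file can only over-approximate that set by ALL solutions of `x^a = ξ^b` — the exact version needs
the restriction apparatus of Cor 2.8 (owner abc-iut-L6-t1 / BLOCK A claimant). -- TODO-merge: L6-t1 Cor 2.8.
[cite: Mochizuki2012, Cor 3.5 (ii) p.94] -/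
def rootPowers {N : Type w} [CommMonoid N] (ξ : N) : Submonoid N := Submonoid.closure (rootPowerSet ξ)

/-- The printed set is closed under multiplication (so `rootPowers ξ = rootPowerSet ξ ∪ {1}` as sets
when `ξ` is not torsion; we only record closure under products). [cite: Mochizuki2012, Ex 3.2 (i) p.88] -/
theorem rootPowerSet_mul_mem {N : Type w} [CommMonoid N] (ξ : N) {x y : N}
    (hx : x ∈ rootPowerSet ξ) (hy : y ∈ rootPowerSet ξ) : x * y ∈ rootPowerSet ξ := by
  obtain ⟨a, b, ha, hb, hx⟩ := hx
  obtain ⟨c, d, hc, hd, hy⟩ := hy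
  refine ⟨a * c, b * c + d * a, Nat.mul_pos ha hc, Nat.add_pos_left (Nat.mul_pos hb hc) _, ?_⟩
  rw [mul_pow, pow_mul, hx, mul_comm a c, pow_mul, hy, ← pow_mul, ← pow_mul, ← pow_add]

/-- `ξ^ℕ ⊆ ξ^{ℚ≥0}`. [cite: Mochizuki2012, Cor 3.5 (ii) p.94] -/
theorem powers_le_rootPowers {N : Type w} [CommMonoid N] (ξ : N) :
    Submonoid.powers ξ ≤ rootPowers ξ := by
  rw [Submonoid.powers_le]
  exact Submonoid.subset_closure ⟨1, 1, Nat.one_pos, Nat.one_pos, by simp⟩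

/-! ### 2. Value-profiles (Cor 3.5 (ii), p. 94) -/

/-- INPUT DATA for Cor 3.5 (ii): at each label `|t| ∈ F_l^⋇`, the finite set
`θ^{|t|}_env(M^Θ_*▶) ⊆ Ψ_cns(M^Θ_*)_{|t|}` of theta values obtained by restriction to the
decomposition groups of the torsion point labeled `|t|` (Cor 2.8 (i)–(ii); by Remark 2.5.1 the
`μ_{2l}`-orbit of `q_v^{j²}`): `2l` elements forming one orbit under the `2l`-th roots of unity.
-- TODO-merge: abc-iut-L6-t1 (Cor 2.8 (i)–(ii), Remark 2.5.1 supply `thetaValues`).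
[cite: Mochizuki2012, Cor 3.5 (ii) p.94] -/
structure ValueProfileData (T : Type u) (M : Type v) [CommMonoid M] (twoL : ℕ) where
  /-- `θ^{|t|}_env ⊆ Ψ_cns,|t|` -/
  thetaValues : T → Finset M
  /-- each has exactly `2l` elements -/
  card_thetaValues : ∀ t, (thetaValues t).card = twoL
  /-- each is one orbit under `μ_{2l}`: any two values at the same label differ by a `2l`-th
  root of unity -/
  orbit : ∀ t, ∀ a ∈ thetaValues t, ∀ b ∈ thetaValues t, ∃ ζ : Mˣ, ζ ^ twoL = 1 ∧ a = ζ * b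

variable {twoL : ℕ} (D : ValueProfileData T M twoL)

/-- `θ^{F_l^⋇}_env := ∏_{|t| ∈ F_l^⋇} θ^{|t|}_env ⊆ ∏_{|t|} Ψ_cns,|t|`, the set of **value-profiles**
([IUTchII] Cor 3.5 (ii) p. 94). [cite: Mochizuki2012, Cor 3.5 (ii) p.94] -/
def ValueProfileData.valueProfiles [DecidableEq T] [Fintype T] : Finset (T → M) :=
  Fintype.piFinset D.thetaValues

/-- A value-profile picks a theta value at every label. [cite: Mochizuki2012, Cor 3.5 (ii) p.94] -/
theorem ValueProfileData.mem_valueProfiles [DecidableEq T] [Fintype T] (ξ : T → M) :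
    ξ ∈ D.valueProfiles ↔ ∀ t, ξ t ∈ D.thetaValues t :=
  Fintype.mem_piFinset

/-- **Cor 3.5 (ii) p. 94: `θ^{F_l^⋇}_env` "is of cardinality `(2l)^{l⋇}`"** (with `l⋇ = |F_l^⋇|`).
[cite: Mochizuki2012, Cor 3.5 (ii) p.94] -/
theorem ValueProfileData.card_valueProfiles [DecidableEq T] [Fintype T] :
    D.valueProfiles.card = twoL ^ Fintype.card T := by
  unfold valueProfiles
  rw [Fintype.card_piFinset]
  simp [D.card_thetaValues]

/-- Two value-profiles have the same `2l`-th power (the computation behind "`Ψ_{2l·ξ}` … is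
independent of the value-profile `ξ`", Cor 3.5 (ii) p. 95). [cite: Mochizuki2012, Cor 3.5 (ii) p.95] -/
theorem ValueProfileData.pow_twoL_eq [DecidableEq T] [Fintype T] {ξ₁ ξ₂ : T → M}
    (h₁ : ξ₁ ∈ D.valueProfiles) (h₂ : ξ₂ ∈ D.valueProfiles) : ξ₁ ^ twoL = ξ₂ ^ twoL := by
  rw [D.mem_valueProfiles] at h₁ h₂
  funext t
  obtain ⟨ζ, hζ, hab⟩ := D.orbit t (ξ₁ t) (h₁ t) (ξ₂ t) (h₂ t)
  simp only [Pi.pow_apply]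
  rw [hab, mul_pow, ← Units.val_pow_eq_pow_val, hζ, Units.val_one, one_mul]

/-! ### 3. Gaussian monoids `Ψ_ξ`, `∞Ψ_ξ`, `Ψ_{2l·ξ}` (Cor 3.5 (ii)–(iii), pp. 94–95) -/

/-- The **Gaussian monoid** `Ψ_ξ := Ψ^×_{⟨F_l^⋇⟩} · ξ^ℕ ⊆ ∏_{|t|} Ψ_{|t|}` attached to a value-profile
`ξ` ([IUTchII] Cor 3.5 (ii) p. 94). [cite: Mochizuki2012, Cor 3.5 (ii) p.94] -/
def gaussianMonoid (ξ : T → M) : Submonoid (T → M) := unitDiagonal T M ⊔ Submonoid.powers ξ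

/-- `∞Ψ_ξ := Ψ^×_{⟨F_l^⋇⟩} · ξ^{ℚ≥0}` ([IUTchII] Cor 3.5 (ii) p. 94–95).
[cite: Mochizuki2012, Cor 3.5 (ii) p.94] -/
def inftyGaussianMonoid (ξ : T → M) : Submonoid (T → M) := unitDiagonal T M ⊔ rootPowers ξ

/-- `Ψ_{2l·ξ} ⊆ Ψ_ξ`: "the submonoid generated by `Ψ^×_cns(M^Θ_*)_{⟨F_l^⋇⟩}` and `ξ^{2l·ℕ}`"
([IUTchII] Cor 3.5 (ii) p. 95). [cite: Mochizuki2012, Cor 3.5 (ii) p.95] -/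
def gaussianMonoid2l (twoL : ℕ) (ξ : T → M) : Submonoid (T → M) :=
  unitDiagonal T M ⊔ Submonoid.powers (ξ ^ twoL)

/-- `Ψ_ξ = Ψ^×_{⟨F_l^⋇⟩} · ξ^ℕ` elementwise: every element is a diagonal unit times a power of `ξ`
(the "splitting up to torsion" presentation of Cor 3.5 (iii) p. 95).
[cite: Mochizuki2012, Cor 3.5 (iii) p.95] -/
theorem mem_gaussianMonoid_iff (ξ x : T → M) :
    x ∈ gaussianMonoid ξ ↔ ∃ (u : Mˣ) (n : ℕ), x = (fun _ => (u : M)) * ξ ^ n := by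
  unfold gaussianMonoid
  rw [Submonoid.mem_sup]
  constructor
  · rintro ⟨y, ⟨u, rfl⟩, z, ⟨n, rfl⟩, rfl⟩
    exact ⟨u, n, rfl⟩
  · rintro ⟨u, n, rfl⟩
    exact ⟨_, ⟨u, rfl⟩, _, ⟨n, rfl⟩, rfl⟩

/-- `Ψ_ξ ⊆ ∞Ψ_ξ` ([IUTchII] Cor 3.5 (ii) p. 95, the vertical inclusions of the third display).
[cite: Mochizuki2012, Cor 3.5 (ii) p.95] -/
theorem gaussianMonoid_le_infty (ξ : T → M) : gaussianMonoid ξ ≤ inftyGaussianMonoid ξ :=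
  sup_le_sup_left (powers_le_rootPowers ξ) _

/-- `Ψ_{2l·ξ} ⊆ Ψ_ξ` ([IUTchII] Cor 3.5 (ii) p. 95). [cite: Mochizuki2012, Cor 3.5 (ii) p.95] -/
theorem gaussianMonoid2l_le (twoL : ℕ) (ξ : T → M) : gaussianMonoid2l twoL ξ ≤ gaussianMonoid ξ := by
  refine sup_le_sup_left ?_ _
  rw [Submonoid.powers_le]
  exact ⟨twoL, rfl⟩

/-- **Cor 3.5 (ii) p. 95, proved:** "the submonoid `Ψ_{2l·ξ}(M^Θ_*) ⊆ Ψ_ξ(M^Θ_*)` generated by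
`Ψ^×_cns(M^Θ_*)_{⟨F_l^⋇⟩}` and `ξ^{2l·ℕ}` is independent of the value-profile `ξ`".
[cite: Mochizuki2012, Cor 3.5 (ii) p.95] -/
theorem ValueProfileData.gaussianMonoid2l_eq [DecidableEq T] [Fintype T] {ξ₁ ξ₂ : T → M}
    (h₁ : ξ₁ ∈ D.valueProfiles) (h₂ : ξ₂ ∈ D.valueProfiles) :
    gaussianMonoid2l twoL ξ₁ = gaussianMonoid2l twoL ξ₂ := by
  unfold gaussianMonoid2l
  rw [D.pow_twoL_eq h₁ h₂]

/-- `Ψ_gau(M^Θ_*) := {Ψ_ξ(M^Θ_*)}_ξ` and `∞Ψ_gau(M^Θ_*) := {∞Ψ_ξ(M^Θ_*)}_ξ`, the two collections of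
Gaussian monoids indexed by the value-profiles ([IUTchII] Cor 3.5 (ii) p. 94).
[cite: Mochizuki2012, Cor 3.5 (ii) p.94] -/
def ValueProfileData.gaussianCollection [DecidableEq T] [Fintype T] :
    D.valueProfiles → Submonoid (T → M) × Submonoid (T → M) :=
  fun ξ => (gaussianMonoid ξ.1, inftyGaussianMonoid ξ.1)

/-! ### 4. Corollary 3.6 (ii)–(iii): Frobenioid-theoretic Gaussian monoids (pp. 99–101) -/

variable {N : Type w} [CommMonoid N]

/-- Componentwise transport along the (copies of the) Kummer isomorphism
`(Ψ_{†C_v})_{|t|} ⥲ Ψ_cns(M^Θ_*)_{|t|}` of Cor 3.6 (i) (one isomorphism `e`, copied at every label).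
[cite: Mochizuki2012, Cor 3.6 (ii) p.99] -/
def piIso (T : Type u) (e : N ≃* M) : (T → N) ≃* (T → M) :=
  MulEquiv.piCongrRight fun _ => e

/-- `Ψ_{F_ξ}(†F_v) ⊆ ∏_{|t|} (Ψ_{†C_v})_{|t|}`: "the submonoid determined, via the isomorphisms
`(Ψ_{†C_v})_{|t|} ⥲ Ψ_cns(M^Θ_*)_{|t|}` of (i), by the monoid `Ψ_ξ(M^Θ_*)`" ([IUTchII] Cor 3.6 (ii)
p. 99–100). [cite: Mochizuki2012, Cor 3.6 (ii) p.99] -/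
def frobenioidGaussianMonoid (e : N ≃* M) (ξ : T → M) : Submonoid (T → N) :=
  (gaussianMonoid ξ).comap (piIso T e).toMonoidHom

/-- `∞Ψ_{F_ξ}(†F_v)`: likewise from `∞Ψ_ξ(M^Θ_*)` ([IUTchII] Cor 3.6 (ii) p. 99–100).
[cite: Mochizuki2012, Cor 3.6 (ii) p.99] -/
def inftyFrobenioidGaussianMonoid (e : N ≃* M) (ξ : T → M) : Submonoid (T → N) :=
  (inftyGaussianMonoid ξ).comap (piIso T e).toMonoidHom

/-- `Ψ_{F_ξ} ⊆ ∞Ψ_{F_ξ}` ([IUTchII] Cor 3.6 (ii) p. 99). [cite: Mochizuki2012, Cor 3.6 (ii) p.99] -/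
theorem frobenioidGaussianMonoid_le_infty (e : N ≃* M) (ξ : T → M) :
    frobenioidGaussianMonoid e ξ ≤ inftyFrobenioidGaussianMonoid e ξ :=
  Submonoid.monotone_comap (gaussianMonoid_le_infty ξ)

/-- **Cor 3.6 (iii) p. 100, proved:** `Ψ_{F_ξ}(†F_v) = (Ψ^×_{†C_v})_{⟨F_l^⋇⟩} · Im(ξ)^ℕ`, "where `Im(ξ)`
denotes the image of `ξ` via the isomorphisms discussed in (ii)" — here `Im(ξ) = e⁻¹ ∘ ξ`.
[cite: Mochizuki2012, Cor 3.6 (iii) p.100] -/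
theorem frobenioidGaussianMonoid_eq (e : N ≃* M) (ξ : T → M) :
    frobenioidGaussianMonoid e ξ = gaussianMonoid (fun t => e.symm (ξ t)) := by
  ext x
  unfold frobenioidGaussianMonoid
  rw [Submonoid.mem_comap, mem_gaussianMonoid_iff, mem_gaussianMonoid_iff]
  constructor
  · rintro ⟨u, n, hx⟩
    refine ⟨Units.map e.symm.toMonoidHom u, n, ?_⟩
    funext t
    have ht := congrFun hx t
    simp only [MulEquiv.toMonoidHom_eq_coe, MonoidHom.coe_coe, piIso,
      MulEquiv.piCongrRight_apply, Pi.mul_apply, Pi.pow_apply] at ht ⊢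
    apply e.injective
    simp [ht]
  · rintro ⟨u, n, rfl⟩
    refine ⟨Units.map e.toMonoidHom u, n, ?_⟩
    funext t
    simp [piIso]

/-! ### 5. The remaining clauses of Corollaries 3.5, 3.6 as named statements -/

/-- INTERFACE, SLOT-ONLY (ref-b PASS-8 B7: every field has TYPE `Prop`, is instantiable by
`True`, and is NOT counted as typed mathematical content): the statement-level content of
[IUTchII] Cor 3.5 (i), the restriction/Galois clauses of (ii)–(iii), Cor 3.6 (i)–(ii), and Remark
3.6.1, over named inputs (mono-theta environments `M^Θ_*`, `Π_X(M^Θ_*)`, `G_v(M^Θ_*▶)`, `LabCusp^±`, the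
theta monoids `Ψ^ι_env` of Prop 3.1 and the tempered Frobenioid `†F_v` of Prop 3.3). Fields quote
print; none is asserted; they are to be replaced by named `Prop`s over real definitions at the
TODO-merges. -- TODO-merge: abc-iut-L6-t1 (Props 1.2–1.5, Cor 2.4, 2.8, 2.9, Def 2.7),
-- abc-iut-L5-t2 ([IUTchI] Ex 3.2), abc-iut-L5-t4 (`LabCusp^±`, [IUTchI] Def 6.1).
[cite: Mochizuki2012, Cor 3.5 (i) p.94] -/
structure Cor35Statements where
  /-- 3.5 (i) p. 94 (Labels, `F_l^⋊±`-symmetries, conjugate synchronization): "the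
  `Δ_X(M^Θ_*)`-outer action of `F_l^⋊± ≅ Δ_C(M^Θ_*)/Δ_X(M^Θ_*)` on `Π_X(M^Θ_*)` … induces isomorphisms
  between the pairs `G_v(M^Θ_*▶)_t ↷ Ψ_cns(M^Θ_*)_t` … for distinct `t ∈ LabCusp^±(Π_X(M^Θ_*))`. We
  shall refer to these isomorphisms as [`F_l^⋊±`-]symmetrizing isomorphisms"; the restricted
  compatible morphisms `Π_{v▶}(M^Θ_*▶) ↠ G_v(M^Θ_*▶)_{⟨|F_l|⟩}` ↷ `Ψ_cns(M^Θ_*) ⥲ Ψ_cns(M^Θ_*)_{⟨|F_l|⟩}`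
  are "well-defined up to composition with an inner automorphism of `Π_X(M^Θ_*)` … in fact,
  independent of `|t| ∈ |F_l|`". -/
  symmetrizing : Prop
  /-- 3.5 (ii) p. 95 (restriction): "the restriction operations … of Corollary 2.8, (i), (ii),
  determine a collection of compatible morphisms `Π_{v▶}(M^Θ_*▶) ↠ {G_v(M^Θ_*▶)_{|t|}}` ↷
  `∞Ψ^ι_env(M^Θ_*) ⥲ ∞Ψ_ξ(M^Θ_*)` ⊇ `Ψ^ι_env(M^Θ_*) ⥲ Ψ_ξ(M^Θ_*)` … well-defined up to composition with
  a(n) [single!] inner automorphism of `Π_X(M^Θ_*)` and compatible with the equalities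
  `Ψ_{2l·ξ₁} = Ψ_{2l·ξ₂}`"; notation `Ψ_env(M^Θ_*) ⥲ Ψ_gau(M^Θ_*)`, `∞Ψ_env ⥲ ∞Ψ_gau`. -/
  restriction : Prop
  /-- 3.5 (ii) p. 95 (Galois action): "each `Ψ_ξ(M^Θ_*)` is equipped with a natural action by
  `G_v(M^Θ_*▶)_{⟨F_l^⋇⟩}`"; Remark 3.6.1 p. 101: the Galois compatibility "corresponds precisely to
  the Galois functoriality … of Remark 1.12.4". -/
  galoisAction : Prop
  /-- 3.5 (iii) p. 95 (splittings): "the restriction operations to zero-labeled evaluation points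
  … determine a splitting up to torsion of each of the Gaussian monoids … compatible, relative to
  the restriction isomorphisms …, with the splittings up to torsion of Proposition 3.1, (i)". -/
  splittingCompatible : Prop
  /-- 3.6 (i) p. 99: "The isomorphism of Proposition 3.3, (ii) … determines, for each
  `t ∈ LabCusp^±`, a collection of compatible morphisms `(Π_X(M^Θ_*)_t ↠) G_v(M^Θ_*)_t ⥲ G_v(M^Θ_*▶)_t`
  ↷ `(Ψ_{†C_v})_t ⥲ Ψ_cns(M^Θ_*)_t` — well-defined up to composition with an inner automorphism …
  independent of `t`" and `F_l^⋊±`-symmetrizing isomorphisms between the data at distinct `t`. -/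
  frobenioidSymmetrizing : Prop
  /-- 3.6 (ii) p. 100: the diagram of compatible morphisms
  `Ψ_{†F^Θ_v,α} ⥲ Ψ^ι_env(M^Θ_*) ⥲ Ψ_ξ(M^Θ_*) ⥲ Ψ_{F_ξ}(†F_v)` (and its `∞`-version), "well-defined up to
  composition with a(n) [single!] inner automorphism of `Π_X(M^Θ_*)`"; notation
  `Ψ_{†F^Θ_v} ⥲ Ψ_env(M^Θ_*) ⥲ Ψ_gau(M^Θ_*) ⥲ Ψ_{F_gau}(†F_v)`. -/
  kummerEvaluationDiagram : Prop
  /-- 3.6 (iii) p. 100–101: "the diagonal submonoid `(Ψ_{†C_v})_{⟨|F_l|⟩}` determines … an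
  isomorphism of monoids `(Ψ_{†C_v})_0 ⥲ (Ψ_{†C_v})_{⟨F_l^⋇⟩}` … compatible with the respective labeled
  `G_v(M^Θ_*)`-actions", and the splittings of `Ψ_{F_ξ}`, `∞Ψ_{F_ξ}` are compatible with those of
  Props 3.1 (i), 3.3 (i), Cor 3.5 (iii). -/
  frobenioidSplittings : Prop

/-- Remark 3.5.1 (i) p. 96 records that taking `γ = 1` in Cor 3.5 "does not result in any
substantive loss of generality" (replace `M^Θ_*` by `(M^Θ_*)^γ`); (ii): the
`Π_X(M^Θ_*)`-conjugacy indeterminacies serve "to identify the various `Π_X(M^Θ_*)`-conjugates of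
`Π_{v▶}(M^Θ_*▶)`". Remark 3.5.3 p. 99: dropping the single-basepoint condition one obtains
symmetrizing isomorphisms from [IUTchI] Props 6.8, 6.9 ("multi-basepoint" approach), compatible
with Cor 3.5 (i) via forgetful functors ("We leave the routine details to the reader").
Recorded as SLOT-ONLY Prop fields (B7: type `Prop`, instantiable by `True`, not typed content)
over the [IUTchI] §6 vocabulary (owner abc-iut-L5-t4).
-- TODO-merge: abc-iut-L5-t4 ([IUTchI] Props 6.8, 6.9). [cite: Mochizuki2012, Rmk 3.5.3 p.99] -/
structure Remark353Statement where
  /-- Remark 3.5.1 (i): no loss of generality in `γ = 1` -/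
  gammaOne : Prop
  /-- Remark 3.5.3: multi-basepoint symmetrization compatible with Cor 3.5 (i) -/
  multiBasepointCompatible : Prop

end BadPrime

end Literature.IUT.HodgeArakelov
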